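import Mathlib
import HarnessLib
import Literature.Computability.Complexity.Space
import Literature.Computability.MetaComplexity.Magnification
import Literature.Computability.MetaComplexity.MCSP
import Summits.PneNP.PneNP.Theorems.UniformStreamUniformStreamLBStubSimulation

/-!
# Transfer of the crux `UniformStreamLB` to a `DTISP` lower bound (`stub_transfer`)

Route `UniformStream`, crux `UniformStreamLB` (stmt-PneNP-16045), line `birth`: the registered stub
`stub_transfer` (`--supports stmt-PneNP-16045`), the budget arithmetic gluing the SIMULATION
(`stub_simulation`, file `UniformStreamUniformStreamLBStubSimulation.lean`: uniform one-pass streaming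
within budget `S` lies in `DTISP((N+1)·(S N + ⌊log₂N⌋ + 1), S N + ⌊log₂N⌋ + 1)`) to the transferred
LOWER BOUND `∃ s` time-constructible `∀ c, MCSP[s] ∉ DTISP(N·s(⌊log₂N⌋)^c, s(⌊log₂N⌋)^c)` (open):
together they give the crux's body verbatim.

**Theorem (`stub_transfer`).** SIM → LB → (body of `UniformStreamLB`). *Proof.* Take the `s` of LB; it is
time constructible, so `s(n) ≥ n`. A uniform streaming decider of `MCSP[s]` with budget
`B_c(N) = s(L)^c + c`, `L = ⌊log₂N⌋`, is put by SIM into `DTISP((N+1)(B_c + L + 1), B_c + L + 1)`; the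
budget lemmas `budget_time_le` / `budget_space_le` bound `(N+1)(s(L)^c + c + L + 1) ≤ K·N·s(L)^(c+1) + K`
and `s(L)^c + c + L + 1 ≤ K·s(L)^(c+1) + K` with `K = (c+3)(s(0)^(c+1) + 3)` (if `s(L) ≥ 1`:
`s^c, c, L, 1 ≤ s^(c+1)`-multiples; if `s(L) = 0` then `L = 0`, `N ≤ 1`), so by monotonicity of `DTISP`
up to constants (`dtisp_mono_const`) the decider lands in `DTISP(N·s(L)^(c+1), s(L)^(c+1))`, excluded
by LB at exponent `c + 1`. Polynomial slack in `(s(L), L)` is free because LB quantifies over every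
exponent. [folklore arithmetic; the classes are Arora–Barak 2009, Def. 5.10]

## References

* S. Arora, B. Barak, *Computational Complexity: A Modern Approach*, CUP 2009, Def. 5.10 (TISP),
  §1.3 (time-constructible functions). [AroraBarak2009]
* D. M. McKay, C. D. Murray, R. R. Williams, STOC 2019, Thm. 1.3 (the streaming hypothesis).
  [MckayMurrayWilliams2019]
-/

set_option linter.dupNamespace false -- `Summit.PneNP.PneNP.…`: summit = sub-problem (D-0017)

noncomputable section

namespace Summit.PneNP.PneNP.Theorems.UniformStreamLB.Birth

open Literature.Computability.Complexity Literature.Computability.MetaComplexity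

namespace Transfer

/-- Core budget estimate, `L = ⌊log₂ N⌋`, `m = s L ≥ L`: if `m ≥ 1` then
`m^c + c + L + 1 ≤ (c+3)·m^(c+1)`; if `m = 0` then the budget is `≤ c + 2`. [folklore] -/
theorem budget_core (s : ℕ → ℕ) (hs : ∀ n, n ≤ s n) (c N : ℕ) :
    (1 ≤ s (Nat.log 2 N) →
      s (Nat.log 2 N) ^ c + c + Nat.log 2 N + 1 ≤ (c + 3) * s (Nat.log 2 N) ^ (c + 1)) ∧
    (s (Nat.log 2 N) = 0 → s (Nat.log 2 N) ^ c + c + Nat.log 2 N + 1 ≤ c + 2) := by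
  set L := Nat.log 2 N
  set m := s L
  have hLm : L ≤ m := hs L
  constructor
  · intro hpos
    have hP : 1 ≤ m ^ (c + 1) := Nat.one_le_pow _ _ hpos
    have hQ : m ^ c ≤ m ^ (c + 1) := Nat.pow_le_pow_right hpos (Nat.le_succ c)
    have hM : m ≤ m ^ (c + 1) := Nat.le_self_pow (by omega) m
    have h3 : c ≤ c * m ^ (c + 1) := Nat.le_mul_of_pos_right c hP
    have hR : (c + 3) * m ^ (c + 1) = c * m ^ (c + 1) + 3 * m ^ (c + 1) := by ring
    omega
  · intro h0
    have hL0 : L = 0 := by omega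
    have hc : m ^ c ≤ 1 := pow_le_one₀ (Nat.zero_le _) (by omega)
    omega

/-- Space budget: `s(L)^c + c + L + 1 ≤ K·s(L)^(c+1) + K` with `K = (c+3)(s(0)^(c+1) + 3)`,
`L = ⌊log₂ N⌋`, for `s(n) ≥ n`. [folklore] -/
theorem budget_space_le (s : ℕ → ℕ) (hs : ∀ n, n ≤ s n) (c N : ℕ) :
    s (Nat.log 2 N) ^ c + c + Nat.log 2 N + 1 ≤
      ((c + 3) * (s 0 ^ (c + 1) + 3)) * s (Nat.log 2 N) ^ (c + 1) + (c + 3) * (s 0 ^ (c + 1) + 3) := by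
  have hK : c + 3 ≤ (c + 3) * (s 0 ^ (c + 1) + 3) := Nat.le_mul_of_pos_right _ (by omega)
  rcases Nat.eq_zero_or_pos (s (Nat.log 2 N)) with h0 | hpos
  · have hX := (budget_core s hs c N).2 h0
    have : 0 ≤ ((c + 3) * (s 0 ^ (c + 1) + 3)) * s (Nat.log 2 N) ^ (c + 1) := Nat.zero_le _
    omega
  · have hX := (budget_core s hs c N).1 hpos
    have hKP : (c + 3) * s (Nat.log 2 N) ^ (c + 1) ≤
        ((c + 3) * (s 0 ^ (c + 1) + 3)) * s (Nat.log 2 N) ^ (c + 1) := Nat.mul_le_mul_right _ hK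
    omega

/-- Time budget: `(N+1)·(s(L)^c + c + L + 1) ≤ K·(N·s(L)^(c+1)) + K` with
`K = (c+3)(s(0)^(c+1) + 3)`, `L = ⌊log₂ N⌋`, for `s(n) ≥ n` (degenerate `s(L) = 0` forces `L = 0`,
`N ≤ 1`; `N = 0` is absorbed by `K ≥ (c+3)(s(0)^(c+1)+1)`). [folklore] -/
theorem budget_time_le (s : ℕ → ℕ) (hs : ∀ n, n ≤ s n) (c N : ℕ) :
    (N + 1) * (s (Nat.log 2 N) ^ c + c + Nat.log 2 N + 1) ≤
      ((c + 3) * (s 0 ^ (c + 1) + 3)) * (N * s (Nat.log 2 N) ^ (c + 1)) +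
        (c + 3) * (s 0 ^ (c + 1) + 3) := by
  set K := (c + 3) * (s 0 ^ (c + 1) + 3) with hKdef
  have hK3 : (c + 3) * 3 ≤ K := Nat.mul_le_mul_left _ (by omega)
  have hLm : Nat.log 2 N ≤ s (Nat.log 2 N) := hs _
  rcases Nat.eq_zero_or_pos (s (Nat.log 2 N)) with h0 | hpos
  · have hX := (budget_core s hs c N).2 h0
    have hL0 : Nat.log 2 N = 0 := by omega
    have hN : N ≤ 1 := by
      rcases Nat.log_eq_zero_iff.mp hL0 with h | h <;> omega
    have h1 : (N + 1) * (s (Nat.log 2 N) ^ c + c + Nat.log 2 N + 1) ≤ 2 * (c + 2) :=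
      Nat.mul_le_mul (by omega) hX
    have : 0 ≤ K * (N * s (Nat.log 2 N) ^ (c + 1)) := Nat.zero_le _
    nlinarith
  · have hX := (budget_core s hs c N).1 hpos
    rcases Nat.eq_zero_or_pos N with hN0 | hNpos
    · subst hN0
      simp only [Nat.log_zero_right] at hX hpos ⊢
      have : (c + 3) * s 0 ^ (c + 1) ≤ K := by
        simp only [hKdef]; exact Nat.mul_le_mul_left _ (by omega)
      omega
    · have h1 : (N + 1) * (s (Nat.log 2 N) ^ c + c + Nat.log 2 N + 1) ≤
          (2 * N) * ((c + 3) * s (Nat.log 2 N) ^ (c + 1)) := Nat.mul_le_mul (by omega) hX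
      have h3 : (2 * N) * ((c + 3) * s (Nat.log 2 N) ^ (c + 1)) =
          (2 * (c + 3)) * (N * s (Nat.log 2 N) ^ (c + 1)) := by ring
      have h5 : (2 * (c + 3)) * (N * s (Nat.log 2 N) ^ (c + 1)) ≤ K * (N * s (Nat.log 2 N) ^ (c + 1)) :=
        Nat.mul_le_mul_right _ (by omega)
      omega

end Transfer

open Transfer Simulation in
/-- **Transfer (`stub_transfer`)** (`sim-sig → lb-sig → crux`; the conclusion is the
crux's body verbatim). Take the `s` of the lower bound; a uniform streaming decider of `MCSP[s]` with
budget `B_c` is simulated into `DTISP((N+1)·(B_c + ⌊log₂N⌋ + 1), B_c + ⌊log₂N⌋ + 1)`, which the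
budget lemmas place inside `DTISP(N·s(⌊log₂N⌋)^(c+1), s(⌊log₂N⌋)^(c+1))` — excluded by Stub 2 at
exponent `c + 1`. [folklore] -/
theorem stub_transfer :
    (∀ (S : ℕ → ℕ) (L : Language Bool),
      (∃ (A : Literature.Computability.MetaComplexity.StreamingAlgorithm)
          (M₀ M₁ M₂ : Turing.TM2ComputableAux Bool Bool),
        A.HasSpace S ∧
        (∀ N : ℕ, M₀.OutputsWithin (Computability.encodeNat N) (A.init N) (S N)) ∧
        (∀ (N : ℕ) (st : List Bool) (b : Bool), st.length ≤ S N →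
          M₁.OutputsWithin (Literature.Computability.Complexity.boolPair st [b]) (A.update N st b) (S N)) ∧
        (∀ (N : ℕ) (st : List Bool), st.length ≤ S N →
          M₂.OutputsWithin st (Computability.encodeBool (A.accept N st)) (S N)) ∧
        A.Decides L) →
      L ∈ Literature.Computability.Complexity.DTISP (fun N => (N + 1) * (S N + Nat.log 2 N + 1))
        (fun N => S N + Nat.log 2 N + 1)) →
    (∃ s : ℕ → ℕ, Literature.Computability.Complexity.IsTimeConstructible s ∧ ∀ c : ℕ,
      Literature.Computability.MetaComplexity.MCSPSize s ∉
        Literature.Computability.Complexity.DTISP (fun N => N * s (Nat.log 2 N) ^ c)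
          (fun N => s (Nat.log 2 N) ^ c)) →
    ∃ s : ℕ → ℕ, Literature.Computability.Complexity.IsTimeConstructible s ∧ ∀ c : ℕ,
      ¬ ∃ (A : Literature.Computability.MetaComplexity.StreamingAlgorithm)
          (M₀ M₁ M₂ : Turing.TM2ComputableAux Bool Bool),
        A.HasSpace (fun N => s (Nat.log 2 N) ^ c + c) ∧
        (∀ N : ℕ, M₀.OutputsWithin (Computability.encodeNat N) (A.init N) (s (Nat.log 2 N) ^ c + c)) ∧
        (∀ (N : ℕ) (st : List Bool) (b : Bool), st.length ≤ s (Nat.log 2 N) ^ c + c →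
          M₁.OutputsWithin (Literature.Computability.Complexity.boolPair st [b]) (A.update N st b)
            (s (Nat.log 2 N) ^ c + c)) ∧
        (∀ (N : ℕ) (st : List Bool), st.length ≤ s (Nat.log 2 N) ^ c + c →
          M₂.OutputsWithin st (Computability.encodeBool (A.accept N st)) (s (Nat.log 2 N) ^ c + c)) ∧
        A.Decides (Literature.Computability.MetaComplexity.MCSPSize s) := by
  intro hsim hlb
  obtain ⟨s, hs, hno⟩ := hlb
  obtain ⟨hsge, -⟩ := id hs
  refine ⟨s, hs, fun c hex => hno (c + 1) ?_⟩
  have hmem := hsim (fun N => s (Nat.log 2 N) ^ c + c)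
    (Literature.Computability.MetaComplexity.MCSPSize s) hex
  exact dtisp_mono_const ((c + 3) * (s 0 ^ (c + 1) + 3)) (fun N => budget_time_le s hsge c N)
    (fun N => budget_space_le s hsge c N) hmem


end Summit.PneNP.PneNP.Theorems.UniformStreamLB.Birth

end
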